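import Summits.CriticalPhenomena.PercolationContinuityZ3.Theses.PercNearOneGluing
import Summits.CriticalPhenomena.PercolationContinuityZ3.Theorems.PercNearOneGluingNoHeavyLowerTailTwoCutMaster
import HarnessLib

/-!
# `NoHeavyLowerTail` (stmt-CriticalPhenomena-4575) — heavy relays reduce the one-cut bound to exit gluing

Support file for the crux `Summit.CriticalPhenomena.PercolationContinuityZ3.Theses.PercNearOneGluing.NoHeavyLowerTail`,
line `one-cut-symmetrisation` (route task nh7-symmetrise), companion of `…OneCutSymmMoves.lean` (the monotone
moves) and `…OneCutSymmTerminal.lean` (the two-blob identity).  No definitions, no named facts, no sorries.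

Setting: `μ = prodBernoulli w` on `Fin n`, relays `A`, observer `o`, `N(ω) = |{a ∈ A : o ↔ a}|`,
`EN = Σ_{a∈A} μ(o ↔ a)`, ratio `ρ ≥ 0`, lower-tail event `B_ρ = {1 ≤ N ∧ N < ρ·EN}`.  A vertex `u` is
HEAVY when `μ(o ↔ u, N < ρ·EN) = 0` (reaching it forces a majority) — the notion behind the saturation and
cloning moves.  This file records what a heavy RELAY buys, with no move at all:

* `lowerTail_le_exit_of_heavy` — if `Hv ⊆ A` consists of heavy relays and `h ∈ Hv`, then up to a null set
  `B_ρ ⊆ {o ↮ h} ∩ ⋃_{a ∈ A ∖ Hv} {o ↔ a}`: the minority event is an EXIT EVENT of the light relays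
  against one heavy relay.
* `oneCut_of_heavyRelay_of_eventGluing` — hence, CONDITIONALLY on event-form additive gluing
  (EG: `(∀ a ∈ A', μ{a ↮ c} ≤ s) ⇒ μ({o ↮ c} ∩ ⋃_{a∈A'} {o ↔ a}) ≤ s`, the hypothesis of
  `Theorems.oneCut_of_blobs_majority_of_eventGluing`), every configuration with a heavy relay satisfies the
  one-cut bound with constant `1`, for EVERY ratio `ρ` — generalising the heavy-blob and majority-blob cases
  (`Theorems.oneCut_of_blobs_heavy`, `…_majority_of_eventGluing`), whose distinguished relay is heavy in this
  sense.
* `oneCut_of_heavy_twoLight` — UNCONDITIONALLY, if all relays but at most two (`a₁, a₂`) are heavy, the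
  one-cut bound holds with constant `1` (heavy-class exit inequality `Theorems.lonelyOrPair_le`, a corollary
  of the tripod exchange inequality C⁺).
* `lowerTail_le_exit_add`, `oneCut_of_quasiHeavy_twoLight` — the same with an ERROR TERM
  `Σ_{u ∈ Hv} μ(o ↔ u, N < ρ·EN)` for arbitrary ("quasi-heavy") `Hv ∋ h`: the form that applies to the
  census's extremisers, which are quasi-two-blob (far blobs glued with probability near one).

So the one-cut engine splits as: (heavy relay present) = Kozma–Nitzan exit gluing of the LIGHT relays against
a heavy one; (no heavy vertex: every blob lighter than `ρ·EN`) = the all-light regime, untouched by the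
compression moves — the census's "many small blobs" core.
-/

noncomputable section

namespace Summit.CriticalPhenomena.PercolationContinuityZ3.Theorems

open MeasureTheory Set Literature.Probability.LatticeModels Literature.Probability.Percolation
open scoped Classical BigOperators

namespace OneCutSymm

variable {n : ℕ}

/-- **Heavy relays turn the minority event into an exit event.**  If every `u ∈ Hv ⊆ A` is heavy
(`μ(o ↔ u, N < ρ·EN) = 0`) and `h ∈ Hv`, then
`μ B_ρ ≤ μ({o ↮ h} ∩ ⋃_{a ∈ A ∖ Hv} {o ↔ a})`. [folklore] -/
theorem lowerTail_le_exit_of_heavy (w : Sym2 (Fin n) → unitInterval) (A Hv : Finset (Fin n))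
    (o h : Fin n) (ρ : ℝ) (hh : h ∈ Hv)
    (hH : ∀ u ∈ Hv, (prodBernoulli w).real (openConn o u ∩ {ω : BondConfig (Fin n) |
        ((A.filter fun a => ω ∈ openConn o a).card : ℝ) <
          ρ * ∑ a ∈ A, (prodBernoulli w).real (openConn o a)}) = 0) :
    (prodBernoulli w).real {ω : BondConfig (Fin n) |
        1 ≤ (A.filter fun a => ω ∈ openConn o a).card ∧
        ((A.filter fun a => ω ∈ openConn o a).card : ℝ) <
          ρ * ∑ a ∈ A, (prodBernoulli w).real (openConn o a)} ≤
    (prodBernoulli w).real ((openConn o h)ᶜ ∩ ⋃ a ∈ A \ Hv, openConn o a) := by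
  classical
  set μ := prodBernoulli w with hμ
  set EN := ∑ a ∈ A, μ.real (openConn o a) with hEN
  set Z := ⋃ u ∈ Hv, (openConn o u ∩ {ω : BondConfig (Fin n) |
      ((A.filter fun a => ω ∈ openConn o a).card : ℝ) < ρ * EN}) with hZ
  have hZ0 : μ.real Z = 0 :=
    le_antisymm ((measureReal_biUnion_finset_le _ _).trans
      (le_of_eq (Finset.sum_eq_zero fun u hu => hH u hu))) measureReal_nonneg
  have hsub : {ω : BondConfig (Fin n) | 1 ≤ (A.filter fun a => ω ∈ openConn o a).card ∧
        ((A.filter fun a => ω ∈ openConn o a).card : ℝ) < ρ * EN} ⊆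
      ((openConn o h)ᶜ ∩ ⋃ a ∈ A \ Hv, openConn o a) ∪ Z := by
    intro ω hω
    by_cases hωZ : ω ∈ Z
    · exact Or.inr hωZ
    refine Or.inl ⟨fun hoh => hωZ (Set.mem_biUnion hh ⟨hoh, hω.2⟩), ?_⟩
    obtain ⟨a, ha⟩ := Finset.card_pos.1 hω.1
    obtain ⟨haA, hoa⟩ := Finset.mem_filter.1 ha
    have haH : a ∉ Hv := fun haH => hωZ (Set.mem_biUnion haH ⟨hoa, hω.2⟩)
    exact Set.mem_biUnion (Finset.mem_sdiff.2 ⟨haA, haH⟩) hoa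
  calc μ.real {ω : BondConfig (Fin n) | 1 ≤ (A.filter fun a => ω ∈ openConn o a).card ∧
          ((A.filter fun a => ω ∈ openConn o a).card : ℝ) < ρ * EN}
      ≤ μ.real (((openConn o h)ᶜ ∩ ⋃ a ∈ A \ Hv, openConn o a) ∪ Z) := measureReal_mono hsub
    _ ≤ μ.real ((openConn o h)ᶜ ∩ ⋃ a ∈ A \ Hv, openConn o a) + μ.real Z :=
        measureReal_union_le _ _
    _ = _ := by rw [hZ0, add_zero]

/-- **One-cut bound from a heavy relay, conditionally on event-form gluing.**  Hypothesis (EG), as in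
`Theorems.oneCut_of_blobs_majority_of_eventGluing`: for all finite `A'`, targets `c` and `s`, if
`μ{a ↮ c} ≤ s` for every `a ∈ A'` then `μ({o ↮ c} ∩ ⋃_{a ∈ A'} {o ↔ a}) ≤ s`.  Conclusion: if some relay
`h ∈ A` is heavy for the ratio `ρ` and all pairwise cuts among distinct relays are `≤ t`, then
`μ{1 ≤ N ∧ N < ρ·EN} ≤ t` (any `ρ`). [folklore] -/
theorem oneCut_of_heavyRelay_of_eventGluing (w : Sym2 (Fin n) → unitInterval) (A : Finset (Fin n))
    (o h : Fin n) (ρ t : ℝ)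
    (hEG : ∀ (A' : Finset (Fin n)) (c : Fin n) (s : ℝ),
      (∀ a ∈ A', (prodBernoulli w).real (openConn a c)ᶜ ≤ s) →
      (prodBernoulli w).real ((openConn o c)ᶜ ∩ ⋃ a ∈ A', openConn o a) ≤ s)
    (hhA : h ∈ A)
    (hheavy : (prodBernoulli w).real (openConn o h ∩ {ω : BondConfig (Fin n) |
        ((A.filter fun a => ω ∈ openConn o a).card : ℝ) <
          ρ * ∑ a ∈ A, (prodBernoulli w).real (openConn o a)}) = 0)
    (hpair : ∀ a ∈ A, ∀ a' ∈ A, a ≠ a' → (prodBernoulli w).real (openConn a a')ᶜ ≤ t) :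
    (prodBernoulli w).real {ω : BondConfig (Fin n) |
        1 ≤ (A.filter fun a => ω ∈ openConn o a).card ∧
        ((A.filter fun a => ω ∈ openConn o a).card : ℝ) <
          ρ * ∑ a ∈ A, (prodBernoulli w).real (openConn o a)} ≤ t := by
  classical
  refine (lowerTail_le_exit_of_heavy w A {h} o h ρ (Finset.mem_singleton_self h)
    (fun u hu => by rw [Finset.mem_singleton.1 hu]; exact hheavy)).trans ?_
  exact hEG (A \ {h}) h t fun a ha => by
    obtain ⟨haA, hah⟩ := Finset.mem_sdiff.1 ha
    exact hpair a haA h hhA (fun e => hah (Finset.mem_singleton.2 e))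

/-- **One-cut bound when at most two relays are light (unconditional).**  If `Hv ⊆ A` consists of heavy
relays, contains `h`, every relay outside `Hv` is `a₁` or `a₂`, and `μ{a₁ ↮ h}, μ{a₂ ↮ h} ≤ t`, then
`μ{1 ≤ N ∧ N < ρ·EN} ≤ t` — by the heavy-class exit inequality `Theorems.lonelyOrPair_le` (tripod
exchange C⁺). [folklore] -/
theorem oneCut_of_heavy_twoLight (w : Sym2 (Fin n) → unitInterval) (A Hv : Finset (Fin n))
    (o h a₁ a₂ : Fin n) (ρ t : ℝ) (hh : h ∈ Hv)
    (hH : ∀ u ∈ Hv, (prodBernoulli w).real (openConn o u ∩ {ω : BondConfig (Fin n) |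
        ((A.filter fun a => ω ∈ openConn o a).card : ℝ) <
          ρ * ∑ a ∈ A, (prodBernoulli w).real (openConn o a)}) = 0)
    (hlight : ∀ a ∈ A, a ∉ Hv → a = a₁ ∨ a = a₂)
    (h1 : (prodBernoulli w).real (openConn a₁ h)ᶜ ≤ t)
    (h2 : (prodBernoulli w).real (openConn a₂ h)ᶜ ≤ t) :
    (prodBernoulli w).real {ω : BondConfig (Fin n) |
        1 ≤ (A.filter fun a => ω ∈ openConn o a).card ∧
        ((A.filter fun a => ω ∈ openConn o a).card : ℝ) <
          ρ * ∑ a ∈ A, (prodBernoulli w).real (openConn o a)} ≤ t := by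
  classical
  refine (lowerTail_le_exit_of_heavy w A Hv o h ρ hh hH).trans ?_
  refine (measureReal_mono fun ω hω => ?_).trans (lonelyOrPair_le w o a₁ a₂ h t h1 h2)
  obtain ⟨hoh, hU⟩ := hω
  refine ⟨hoh, ?_⟩
  simp only [Set.mem_iUnion, exists_prop] at hU
  obtain ⟨a, ha, hoa⟩ := hU
  obtain ⟨haA, haH⟩ := Finset.mem_sdiff.1 ha
  rcases hlight a haA haH with rfl | rfl
  · exact Or.inl hoa
  · exact Or.inr hoa

/-! ## Quasi-heavy relays: the exit reduction with an error term -/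

/-- **Exit reduction with an error term (quasi-heavy relays).**  For ANY `Hv ⊆ A` with `h ∈ Hv`:
`μ B_ρ ≤ μ({o ↮ h} ∩ ⋃_{a ∈ A ∖ Hv} {o ↔ a}) + Σ_{u ∈ Hv} μ(o ↔ u, N < ρ·EN)`.  With heavy relays the
error vanishes (`lowerTail_le_exit_of_heavy`); the census's extremisers are QUASI-two-blob (far blobs glued
with probability close to, not equal to, one), where this is the form that applies. [folklore] -/
theorem lowerTail_le_exit_add (w : Sym2 (Fin n) → unitInterval) (A Hv : Finset (Fin n))
    (o h : Fin n) (ρ : ℝ) (hh : h ∈ Hv) :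
    (prodBernoulli w).real {ω : BondConfig (Fin n) |
        1 ≤ (A.filter fun a => ω ∈ openConn o a).card ∧
        ((A.filter fun a => ω ∈ openConn o a).card : ℝ) <
          ρ * ∑ a ∈ A, (prodBernoulli w).real (openConn o a)} ≤
    (prodBernoulli w).real ((openConn o h)ᶜ ∩ ⋃ a ∈ A \ Hv, openConn o a) +
      ∑ u ∈ Hv, (prodBernoulli w).real (openConn o u ∩ {ω : BondConfig (Fin n) |
        ((A.filter fun a => ω ∈ openConn o a).card : ℝ) <
          ρ * ∑ a ∈ A, (prodBernoulli w).real (openConn o a)}) := by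
  classical
  set μ := prodBernoulli w with hμ
  set EN := ∑ a ∈ A, μ.real (openConn o a) with hEN
  set Z := ⋃ u ∈ Hv, (openConn o u ∩ {ω : BondConfig (Fin n) |
      ((A.filter fun a => ω ∈ openConn o a).card : ℝ) < ρ * EN}) with hZ
  have hsub : {ω : BondConfig (Fin n) | 1 ≤ (A.filter fun a => ω ∈ openConn o a).card ∧
        ((A.filter fun a => ω ∈ openConn o a).card : ℝ) < ρ * EN} ⊆
      ((openConn o h)ᶜ ∩ ⋃ a ∈ A \ Hv, openConn o a) ∪ Z := by
    intro ω hω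
    by_cases hωZ : ω ∈ Z
    · exact Or.inr hωZ
    refine Or.inl ⟨fun hoh => hωZ (Set.mem_biUnion hh ⟨hoh, hω.2⟩), ?_⟩
    obtain ⟨a, ha⟩ := Finset.card_pos.1 hω.1
    obtain ⟨haA, hoa⟩ := Finset.mem_filter.1 ha
    have haH : a ∉ Hv := fun haH => hωZ (Set.mem_biUnion haH ⟨hoa, hω.2⟩)
    exact Set.mem_biUnion (Finset.mem_sdiff.2 ⟨haA, haH⟩) hoa
  calc μ.real {ω : BondConfig (Fin n) | 1 ≤ (A.filter fun a => ω ∈ openConn o a).card ∧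
          ((A.filter fun a => ω ∈ openConn o a).card : ℝ) < ρ * EN}
      ≤ μ.real (((openConn o h)ᶜ ∩ ⋃ a ∈ A \ Hv, openConn o a) ∪ Z) := measureReal_mono hsub
    _ ≤ μ.real ((openConn o h)ᶜ ∩ ⋃ a ∈ A \ Hv, openConn o a) + μ.real Z :=
        measureReal_union_le _ _
    _ ≤ _ := by
        refine add_le_add le_rfl ?_
        exact measureReal_biUnion_finset_le _ _

/-- **Quasi-heavy two-light bound.**  For any `Hv ⊆ A` with `h ∈ Hv`, if every relay outside `Hv` is `a₁`
or `a₂` and `μ{a₁ ↮ h}, μ{a₂ ↮ h} ≤ t`, then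
`μ{1 ≤ N ∧ N < ρ·EN} ≤ t + Σ_{u ∈ Hv} μ(o ↔ u, N < ρ·EN)` (heavy-class exit inequality plus the quasi-heavy
error). [folklore] -/
theorem oneCut_of_quasiHeavy_twoLight (w : Sym2 (Fin n) → unitInterval) (A Hv : Finset (Fin n))
    (o h a₁ a₂ : Fin n) (ρ t : ℝ) (hh : h ∈ Hv)
    (hlight : ∀ a ∈ A, a ∉ Hv → a = a₁ ∨ a = a₂)
    (h1 : (prodBernoulli w).real (openConn a₁ h)ᶜ ≤ t)
    (h2 : (prodBernoulli w).real (openConn a₂ h)ᶜ ≤ t) :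
    (prodBernoulli w).real {ω : BondConfig (Fin n) |
        1 ≤ (A.filter fun a => ω ∈ openConn o a).card ∧
        ((A.filter fun a => ω ∈ openConn o a).card : ℝ) <
          ρ * ∑ a ∈ A, (prodBernoulli w).real (openConn o a)} ≤
      t + ∑ u ∈ Hv, (prodBernoulli w).real (openConn o u ∩ {ω : BondConfig (Fin n) |
        ((A.filter fun a => ω ∈ openConn o a).card : ℝ) <
          ρ * ∑ a ∈ A, (prodBernoulli w).real (openConn o a)}) := by
  classical
  refine (lowerTail_le_exit_add w A Hv o h ρ hh).trans (add_le_add ?_ le_rfl)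
  refine (measureReal_mono fun ω hω => ?_).trans (lonelyOrPair_le w o a₁ a₂ h t h1 h2)
  obtain ⟨hoh, hU⟩ := hω
  refine ⟨hoh, ?_⟩
  simp only [Set.mem_iUnion, exists_prop] at hU
  obtain ⟨a, ha, hoa⟩ := hU
  obtain ⟨haA, haH⟩ := Finset.mem_sdiff.1 ha
  rcases hlight a haA haH with rfl | rfl
  · exact Or.inl hoa
  · exact Or.inr hoa

end OneCutSymm

end Summit.CriticalPhenomena.PercolationContinuityZ3.Theorems

end
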